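import Summits.QuantumFields.YangMills.Theorems.ColdStartUniversalityLatticeLangevinLiebRobinsonCouplingGenerator
import HarnessLib

/-!
# Route `ColdStartUniversality` (fixed-cut-off SZZ dynamics; LIEB–ROBINSON / LOCALITY package, file 40):
# ★★★ THE COUPLING LIGHT CONE, integrated form — `|∫ H·κ¹_tF dμ_(β₁) − ∫ H·κ²_tF dμ_(β₁)| ≤ 13824π|β₁−β₂|·t·e^(λ₂t)·Σℓ^F·∫H dμ_(β₁)`

Helper file (seat `ym-line-csu-p1`, g32; `--supports stmt-QuantumFields-24809`).  Two `SU(2)` SZZ dynamics on `(ℤ/L)³` at couplings `β₁`, `β₂`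
(realising Markov kernel families `κ¹`, `κ²`), compared on a local observable by DUHAMEL IN DUAL FORM: `Ψ(s) = ∫ κ¹_sH·κ²_(t−s)F dμ_(β₁)` has
`Ψ' = ∫ κ¹_sH·(𝓛_(β₁) − 𝓛_(β₂))(κ²_(t−s)F) dμ_(β₁)` (Dynkin for each family at its `C³_c` representatives, symmetry of `𝓛_(β₁)` under `μ_(β₁)`,
`integral_mul_generator_symm`), and `|(𝓛_(β₁) − 𝓛_(β₂))g| ≤ 2304π|β₁−β₂|Σ_e ℓ^g_e` (file 39, `abs_generator_sub_generator_le`) with the Lieb–Robinson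
profile of `κ²_rF` (g30, `transitionKernel_linkLipschitz_profile`; `Σ_e ℓ_e ≤ 6e^(λ₂r)Σℓ^F` by the volume-free torus sum):
* ★★★ `abs_integral_mul_transition_sub_transition_le_coupling` — for `C³` compactly supported `f, h`, `H = h∘coords ≥ 0`, profile `ℓ^F` of
  `f∘coords`, every `t`: `|∫ H·κ¹_tF dμ_(β₁) − ∫ H·κ²_tF dμ_(β₁)| ≤ 13824π·|β₁ − β₂|·t·e^(λ₂t)·Σ_e ℓ^F_e·∫H dμ_(β₁)`, `λ₂ = |β₂|(4+4√2+12·108)`.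
The pointwise form (every start: the cold-start expectation of a local observable is LIPSCHITZ IN THE COUPLING, uniformly in the volume) and the
two-solution form follow in file 41.  THEOREMS ONLY, no definition, no sorry; [folklore] (Duhamel / variation of constants for Markov semigroups).
HONEST FRAMING: fixed cut-off, every coupling; the constant grows like `t·e^(λ₂t)` with `λ₂ ∝ |β₂|` — nothing `K`-uniform in physical units along the
route's scaling; `UniformColdStartMixing` (24809) is NOT restated; no crux, rung or summit statement is proved; the Yang–Mills mass gap is NOT proved.
-/

set_option autoImplicit false

noncomputable section

namespace Summit.QuantumFields.YangMills.Theorems.ColdStartUniversality.LiebRobinson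

open MeasureTheory ProbabilityTheory Matrix Complex Finset Filter Set Metric
open scoped ComplexConjugate BigOperators Matrix NNReal ENNReal Topology
open Literature.Probability.Process Literature.MathematicalPhysics.QuantumFieldTheory
open Literature.MathematicalPhysics.QuantumFieldTheory.Balaban1983to89
open Literature.MathematicalPhysics.QuantumLattice (fundamentalRep fundamentalLatticeRep continuous_fundamentalRep fundamentalRep_apply)

variable {L : ℕ} [NeZero L]

/-! ## The coupling flow -/

/-- ★★★ **Coupling light cone, integrated form.**  Let `κ¹`, `κ²` be Markov kernel families realising the SZZ transition laws at the couplings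
`β₁`, `β₂` (every volume).  For `C³` compactly supported `f, h` with `H = h∘coords ≥ 0`, link-Lipschitz profile `ℓ^F ≥ 0` of `f∘coords`, every `t`:
`|∫ H·κ¹_tF dμ_(β₁) − ∫ H·κ²_tF dμ_(β₁)| ≤ 13824π·|β₁ − β₂|·t·e^(λ₂t)·Σ_e ℓ^F_e·∫ H dμ_(β₁)`, `λ₂ = |β₂|(4+4√2+12·108)`.  Duhamel in dual form:
`Ψ(s) = ∫ κ¹_sH·κ²_(t−s)F dμ_(β₁)` has `Ψ' = ∫ κ¹_sH·(𝓛_(β₁) − 𝓛_(β₂))κ²_(t−s)F dμ_(β₁)` (Dynkin for both families, symmetry of `𝓛_(β₁)` under `μ_(β₁)`),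
bounded through `abs_generator_sub_generator_le` by the Lieb–Robinson profile of `κ²_(t−s)F` (`Σ_e ℓ_e ≤ 6e^(λ₂(t−s))Σℓ^F`, volume-free).
[folklore] -/
theorem abs_integral_mul_transition_sub_transition_le_coupling (L : ℕ) [NeZero L] (β₁ β₂ : ℝ)
    (κ₁ : ℝ≥0 → Kernel (GaugeConfig 3 L (Matrix.specialUnitaryGroup (Fin 2) ℂ))
      (GaugeConfig 3 L (Matrix.specialUnitaryGroup (Fin 2) ℂ))) [∀ t, IsMarkovKernel (κ₁ t)]
    (hreal₁ : ∀ (t : ℝ≥0) (x : GaugeConfig 3 L (Matrix.specialUnitaryGroup (Fin 2) ℂ))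
        (Ω : Type) [MeasurableSpace Ω] (P : Measure Ω) [IsProbabilityMeasure P]
        (W : ℝ≥0 → Ω → (Edge 3 L × NoiseIdx 2 → ℝ)) (hW : IsFlatBrownian W P)
        (U : ℝ≥0 → Ω → GaugeConfig 3 L (Matrix.specialUnitaryGroup (Fin 2) ℂ)),
        (∀ ω, U 0 ω = x) →
        (latticeLangevinDynamics (fundamentalLatticeRep 2) β₁).IsSolution (fundamentalRep (Fin 2))
          hW.natFiltration P W U →
        κ₁ t x = P.map (U t))
    (κ₂ : ℝ≥0 → Kernel (GaugeConfig 3 L (Matrix.specialUnitaryGroup (Fin 2) ℂ))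
      (GaugeConfig 3 L (Matrix.specialUnitaryGroup (Fin 2) ℂ))) [∀ t, IsMarkovKernel (κ₂ t)]
    (hreal₂ : ∀ (t : ℝ≥0) (x : GaugeConfig 3 L (Matrix.specialUnitaryGroup (Fin 2) ℂ))
        (Ω : Type) [MeasurableSpace Ω] (P : Measure Ω) [IsProbabilityMeasure P]
        (W : ℝ≥0 → Ω → (Edge 3 L × NoiseIdx 2 → ℝ)) (hW : IsFlatBrownian W P)
        (U : ℝ≥0 → Ω → GaugeConfig 3 L (Matrix.specialUnitaryGroup (Fin 2) ℂ)),
        (∀ ω, U 0 ω = x) →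
        (latticeLangevinDynamics (fundamentalLatticeRep 2) β₂).IsSolution (fundamentalRep (Fin 2))
          hW.natFiltration P W U →
        κ₂ t x = P.map (U t))
    {f : (Edge 3 L × Fin 2 × Fin 2 × Bool → ℝ) → ℝ} (hf : ContDiff ℝ 3 f) (hfc : HasCompactSupport f) {ℓF : Edge 3 L → ℝ} (hℓF : ∀ e, 0 ≤ ℓF e)
    {h : (Edge 3 L × Fin 2 × Fin 2 × Bool → ℝ) → ℝ} (hh : ContDiff ℝ 3 h) (hhc : HasCompactSupport h) (t : ℝ≥0) :
    let coords : GaugeConfig 3 L (Matrix.specialUnitaryGroup (Fin 2) ℂ) → (Edge 3 L × Fin 2 × Fin 2 × Bool → ℝ) :=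
      fun V q => (fun z : ℂ => if q.2.2.2 then z.im else z.re)
        ((fundamentalRep (Fin 2) (V q.1) : Matrix (Fin 2) (Fin 2) ℂ) q.2.1 q.2.2.1)
    (∀ x, 0 ≤ h (coords x)) →
    (∀ (e : Edge 3 L) (y y' : (GaugeConfig 3 L (Matrix.specialUnitaryGroup (Fin 2) ℂ))), (∀ f', f' ≠ e → y f' = y' f') →
      |f (coords y) - f (coords y')| ≤ ℓF e * frobNorm ((y e : Matrix (Fin 2) (Fin 2) ℂ) - (y' e : Matrix (Fin 2) (Fin 2) ℂ))) →
    |(∫ x, h (coords x) * (∫ y, f (coords y) ∂(κ₁ t x)) ∂(wilsonMeasure (d := 3) (L := L) (fundamentalRep (Fin 2)) β₁)) -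
        ∫ x, h (coords x) * (∫ y, f (coords y) ∂(κ₂ t x)) ∂(wilsonMeasure (d := 3) (L := L) (fundamentalRep (Fin 2)) β₁)| ≤
      13824 * Real.pi * |β₁ - β₂| * (t : ℝ) * Real.exp ((|β₂| * (4 + 4 * Real.sqrt 2 + 12 * 108)) * (t : ℝ)) * (∑ e : Edge 3 L, ℓF e) *
        ∫ x, h (coords x) ∂(wilsonMeasure (d := 3) (L := L) (fundamentalRep (Fin 2)) β₁) := by
  intro coords hh0 hLf
  classical
  set gen₁ : ((Edge 3 L × Fin 2 × Fin 2 × Bool → ℝ) → ℝ) → (GaugeConfig 3 L (Matrix.specialUnitaryGroup (Fin 2) ℂ)) → ℝ := fun φ V =>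
      (∑ i : Edge 3 L × Fin 2 × Fin 2 × Bool, fderiv ℝ φ (coords V) (Pi.single i 1) *
          (fun z : ℂ => if i.2.2.2 then z.im else z.re)
            ((latticeLangevinDynamics (fundamentalLatticeRep 2) β₁).drift
              (matrixConfig (fundamentalRep (Fin 2)) V) i.1 i.2.1 i.2.2.1) +
      1 / 2 * ∑ i : Edge 3 L × Fin 2 × Fin 2 × Bool, ∑ j : Edge 3 L × Fin 2 × Fin 2 × Bool,
        fderiv ℝ (fun z => fderiv ℝ φ z (Pi.single i 1)) (coords V) (Pi.single j 1) *
          ∑ n : Edge 3 L × NoiseIdx 2,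
            (if n.1 = i.1 then (fun z : ℂ => if i.2.2.2 then z.im else z.re)
              ((latticeLangevinDynamics (fundamentalLatticeRep 2) β₁).noise
                (matrixConfig (fundamentalRep (Fin 2)) V) i.1 n.2 i.2.1 i.2.2.1) else 0) *
            (if n.1 = j.1 then (fun z : ℂ => if j.2.2.2 then z.im else z.re)
              ((latticeLangevinDynamics (fundamentalLatticeRep 2) β₁).noise
                (matrixConfig (fundamentalRep (Fin 2)) V) j.1 n.2 j.2.1 j.2.2.1) else 0)) with hgen₁_def
  set gen₂ : ((Edge 3 L × Fin 2 × Fin 2 × Bool → ℝ) → ℝ) → (GaugeConfig 3 L (Matrix.specialUnitaryGroup (Fin 2) ℂ)) → ℝ := fun φ V =>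
      (∑ i : Edge 3 L × Fin 2 × Fin 2 × Bool, fderiv ℝ φ (coords V) (Pi.single i 1) *
          (fun z : ℂ => if i.2.2.2 then z.im else z.re)
            ((latticeLangevinDynamics (fundamentalLatticeRep 2) β₂).drift
              (matrixConfig (fundamentalRep (Fin 2)) V) i.1 i.2.1 i.2.2.1) +
      1 / 2 * ∑ i : Edge 3 L × Fin 2 × Fin 2 × Bool, ∑ j : Edge 3 L × Fin 2 × Fin 2 × Bool,
        fderiv ℝ (fun z => fderiv ℝ φ z (Pi.single i 1)) (coords V) (Pi.single j 1) *
          ∑ n : Edge 3 L × NoiseIdx 2,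
            (if n.1 = i.1 then (fun z : ℂ => if i.2.2.2 then z.im else z.re)
              ((latticeLangevinDynamics (fundamentalLatticeRep 2) β₂).noise
                (matrixConfig (fundamentalRep (Fin 2)) V) i.1 n.2 i.2.1 i.2.2.1) else 0) *
            (if n.1 = j.1 then (fun z : ℂ => if j.2.2.2 then z.im else z.re)
              ((latticeLangevinDynamics (fundamentalLatticeRep 2) β₂).noise
                (matrixConfig (fundamentalRep (Fin 2)) V) j.1 n.2 j.2.1 j.2.2.1) else 0)) with hgen₂_def
  haveI := secondCountableTopology_su2
  haveI := borelSpace_config L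
  set μ : Measure (GaugeConfig 3 L (Matrix.specialUnitaryGroup (Fin 2) ℂ)) := (wilsonMeasure (d := 3) (L := L) (fundamentalRep (Fin 2)) β₁) with hμ
  haveI : IsProbabilityMeasure μ :=
    isProbabilityMeasure_wilsonMeasure (d := 3) (L := L) (fundamentalRep (Fin 2)) (continuous_fundamentalRep (Fin 2)) β₁
  have hco : Continuous coords := continuous_coords (L := L)
  have hInt : ∀ {Φ : (GaugeConfig 3 L (Matrix.specialUnitaryGroup (Fin 2) ℂ)) → ℝ}, Continuous Φ → Integrable Φ μ := fun hΦ => integrable_of_continuous_of_compactSpace hΦ μ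
  have hκ10 : κ₁ 0 = Kernel.id := transitionKernel_zero_eq_id (L := L) (β' := β₁) κ₁ hreal₁
  have hκ20 : κ₂ 0 = Kernel.id := transitionKernel_zero_eq_id (L := L) (β' := β₂) κ₂ hreal₂
  set lam : ℝ := (|β₂| * (4 + 4 * Real.sqrt 2 + 12 * 108)) with hlam
  have hlam0 : 0 ≤ lam := by rw [hlam]; positivity
  set SF : ℝ := ∑ e : Edge 3 L, ℓF e with hSF
  have hSF0 : 0 ≤ SF := Finset.sum_nonneg fun e _ => hℓF e
  set IH : ℝ := ∫ x, h (coords x) ∂μ with hIH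
  -- §1 representatives: `κ²_s F` (coupling `β₂`) and `κ¹_s H` (coupling `β₁`)
  have hBKf := fun s : ℝ≥0 => transitionKernel_backwardKolmogorov (L := L) β₂ κ₂ hreal₂ hf hfc s
  have hBKh := fun s : ℝ≥0 => transitionKernel_backwardKolmogorov (L := L) β₁ κ₁ hreal₁ hh hhc s
  choose gF hgF hgFc hgFrep hgFcomm _ using hBKf
  choose gH hgH hgHc hgHrep hgHcomm _ using hBKh
  have hgFrep' : ∀ (s : ℝ≥0) (x : (GaugeConfig 3 L (Matrix.specialUnitaryGroup (Fin 2) ℂ))), ∫ y, f (coords y) ∂(κ₂ s x) = gF s (coords x) := fun s x => hgFrep s x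
  have hgHrep' : ∀ (s : ℝ≥0) (x : (GaugeConfig 3 L (Matrix.specialUnitaryGroup (Fin 2) ℂ))), ∫ y, h (coords y) ∂(κ₁ s x) = gH s (coords x) := fun s x => hgHrep s x
  have hgFcomm' : ∀ (s : ℝ≥0) (x : (GaugeConfig 3 L (Matrix.specialUnitaryGroup (Fin 2) ℂ))), gen₂ (gF s) x = ∫ y, gen₂ f y ∂(κ₂ s x) := fun s x => hgFcomm s x
  have hgHcomm' : ∀ (s : ℝ≥0) (x : (GaugeConfig 3 L (Matrix.specialUnitaryGroup (Fin 2) ℂ))), gen₁ (gH s) x = ∫ y, gen₁ h y ∂(κ₁ s x) := fun s x => hgHcomm s x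
  -- §2 kernel actions as functions of real time
  have cF : Continuous fun y : (GaugeConfig 3 L (Matrix.specialUnitaryGroup (Fin 2) ℂ)) => f (coords y) := hf.continuous.comp hco
  have cH : Continuous fun y : (GaugeConfig 3 L (Matrix.specialUnitaryGroup (Fin 2) ℂ)) => h (coords y) := hh.continuous.comp hco
  have cAf : Continuous (gen₂ f) := continuous_generator (L := L) β₂ (hf.of_le (by norm_num))
  have cBh : Continuous (gen₁ h) := continuous_generator (L := L) β₁ (hh.of_le (by norm_num))
  obtain ⟨PF, hPF⟩ : ∃ PF : ℝ → (GaugeConfig 3 L (Matrix.specialUnitaryGroup (Fin 2) ℂ)) → ℝ, PF = fun τ x => ∫ y, f (coords y) ∂(κ₂ τ.toNNReal x) := ⟨_, rfl⟩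
  obtain ⟨PAF, hPAF⟩ : ∃ PAF : ℝ → (GaugeConfig 3 L (Matrix.specialUnitaryGroup (Fin 2) ℂ)) → ℝ, PAF = fun τ x => ∫ y, gen₂ f y ∂(κ₂ τ.toNNReal x) := ⟨_, rfl⟩
  obtain ⟨PH, hPH⟩ : ∃ PH : ℝ → (GaugeConfig 3 L (Matrix.specialUnitaryGroup (Fin 2) ℂ)) → ℝ, PH = fun τ x => ∫ y, h (coords y) ∂(κ₁ τ.toNNReal x) := ⟨_, rfl⟩
  obtain ⟨PB, hPB⟩ : ∃ PB : ℝ → (GaugeConfig 3 L (Matrix.specialUnitaryGroup (Fin 2) ℂ)) → ℝ, PB = fun τ x => ∫ y, gen₁ h y ∂(κ₁ τ.toNNReal x) := ⟨_, rfl⟩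
  have hbd : ∀ (κ : ℝ≥0 → Kernel (GaugeConfig 3 L (Matrix.specialUnitaryGroup (Fin 2) ℂ)) (GaugeConfig 3 L (Matrix.specialUnitaryGroup (Fin 2) ℂ))) [∀ t, IsMarkovKernel (κ t)] {Φ : (GaugeConfig 3 L (Matrix.specialUnitaryGroup (Fin 2) ℂ)) → ℝ}, Continuous Φ →
      ∃ M : ℝ, ∀ (τ : ℝ) (x : (GaugeConfig 3 L (Matrix.specialUnitaryGroup (Fin 2) ℂ))), |∫ y, Φ y ∂(κ τ.toNNReal x)| ≤ M := by
    intro κ _ Φ hΦ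
    obtain ⟨M, hM⟩ : ∃ M, ∀ y : (GaugeConfig 3 L (Matrix.specialUnitaryGroup (Fin 2) ℂ)), |Φ y| ≤ M := by
      obtain ⟨M, hM⟩ := isCompact_univ.exists_bound_of_continuousOn hΦ.continuousOn
      exact ⟨M, fun y => by simpa [Real.norm_eq_abs] using hM y (Set.mem_univ y)⟩
    refine ⟨M, fun τ x => ?_⟩
    haveI : IsProbabilityMeasure (κ τ.toNNReal x) := IsMarkovKernel.isProbabilityMeasure x
    refine (MeasureTheory.abs_integral_le_integral_abs).trans ?_
    calc ∫ y, |Φ y| ∂(κ τ.toNNReal x) ≤ ∫ _y, M ∂(κ τ.toNNReal x) :=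
          integral_mono (integrable_of_continuous_of_compactSpace (continuous_abs.comp hΦ) _) (integrable_const _) fun y => hM y
      _ = M := by simp
  have hDer1 : ∀ {φ : (Edge 3 L × Fin 2 × Fin 2 × Bool → ℝ) → ℝ}, ContDiff ℝ 3 φ → HasCompactSupport φ → ∀ (x : (GaugeConfig 3 L (Matrix.specialUnitaryGroup (Fin 2) ℂ))) {τ : ℝ}, 0 < τ →
      HasDerivAt (fun τ : ℝ => ∫ y, φ (coords y) ∂(κ₁ τ.toNNReal x)) (∫ y, gen₁ φ y ∂(κ₁ τ.toNNReal x)) τ := by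
    intro φ hφ hφc x τ hτ
    have hDf := fun {σ : ℝ} (hσ : (0 : ℝ) ≤ σ) => transitionKernel_dynkin (L := L) β₁ κ₁ hreal₁ hφ hφc x hσ
    have hgc : Continuous (gen₁ φ) := continuous_generator (L := L) β₁ (hφ.of_le (by norm_num))
    have hac : Continuous fun r : ℝ => ∫ y, gen₁ φ y ∂(κ₁ r.toNNReal x) :=
      (continuous_transitionKernel_action (L := L) β₁ κ₁ hreal₁ hgc).comp (continuous_real_toNNReal.prodMk continuous_const)
    have hder : HasDerivAt (fun σ : ℝ => φ (coords x) + ∫ r in (0 : ℝ)..σ, ∫ y, gen₁ φ y ∂(κ₁ r.toNNReal x))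
        (∫ y, gen₁ φ y ∂(κ₁ τ.toNNReal x)) τ :=
      ((intervalIntegral.integral_hasDerivAt_right (hac.intervalIntegrable _ _)
        (hac.stronglyMeasurableAtFilter _ _) hac.continuousAt)).const_add _
    refine hder.congr_of_eventuallyEq ?_
    filter_upwards [Ioi_mem_nhds hτ] with σ hσ
    exact hDf (le_of_lt hσ)
  have hDer2 : ∀ {φ : (Edge 3 L × Fin 2 × Fin 2 × Bool → ℝ) → ℝ}, ContDiff ℝ 3 φ → HasCompactSupport φ → ∀ (x : (GaugeConfig 3 L (Matrix.specialUnitaryGroup (Fin 2) ℂ))) {τ : ℝ}, 0 < τ →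
      HasDerivAt (fun τ : ℝ => ∫ y, φ (coords y) ∂(κ₂ τ.toNNReal x)) (∫ y, gen₂ φ y ∂(κ₂ τ.toNNReal x)) τ := by
    intro φ hφ hφc x τ hτ
    have hDf := fun {σ : ℝ} (hσ : (0 : ℝ) ≤ σ) => transitionKernel_dynkin (L := L) β₂ κ₂ hreal₂ hφ hφc x hσ
    have hgc : Continuous (gen₂ φ) := continuous_generator (L := L) β₂ (hφ.of_le (by norm_num))
    have hac : Continuous fun r : ℝ => ∫ y, gen₂ φ y ∂(κ₂ r.toNNReal x) :=
      (continuous_transitionKernel_action (L := L) β₂ κ₂ hreal₂ hgc).comp (continuous_real_toNNReal.prodMk continuous_const)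
    have hder : HasDerivAt (fun σ : ℝ => φ (coords x) + ∫ r in (0 : ℝ)..σ, ∫ y, gen₂ φ y ∂(κ₂ r.toNNReal x))
        (∫ y, gen₂ φ y ∂(κ₂ τ.toNNReal x)) τ :=
      ((intervalIntegral.integral_hasDerivAt_right (hac.intervalIntegrable _ _)
        (hac.stronglyMeasurableAtFilter _ _) hac.continuousAt)).const_add _
    refine hder.congr_of_eventuallyEq ?_
    filter_upwards [Ioi_mem_nhds hτ] with σ hσ
    exact hDf (le_of_lt hσ)
  have hcx : ∀ (κ : ℝ≥0 → Kernel (GaugeConfig 3 L (Matrix.specialUnitaryGroup (Fin 2) ℂ)) (GaugeConfig 3 L (Matrix.specialUnitaryGroup (Fin 2) ℂ))) [∀ t, IsMarkovKernel (κ t)]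
      (β : ℝ) (hreal : ∀ (t : ℝ≥0) (x : GaugeConfig 3 L (Matrix.specialUnitaryGroup (Fin 2) ℂ))
        (Ω : Type) [MeasurableSpace Ω] (P : Measure Ω) [IsProbabilityMeasure P]
        (W : ℝ≥0 → Ω → (Edge 3 L × NoiseIdx 2 → ℝ)) (hW : IsFlatBrownian W P)
        (U : ℝ≥0 → Ω → GaugeConfig 3 L (Matrix.specialUnitaryGroup (Fin 2) ℂ)),
        (∀ ω, U 0 ω = x) →
        (latticeLangevinDynamics (fundamentalLatticeRep 2) β).IsSolution (fundamentalRep (Fin 2))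
          hW.natFiltration P W U →
        κ t x = P.map (U t)) {Φ : (GaugeConfig 3 L (Matrix.specialUnitaryGroup (Fin 2) ℂ)) → ℝ}, Continuous Φ → ∀ τ : ℝ, Continuous fun x => ∫ y, Φ y ∂(κ τ.toNNReal x) :=
    fun κ _ β hreal Φ hΦ τ => continuous_integral_transitionKernel L β κ hreal τ.toNNReal hΦ
  have hct : ∀ (κ : ℝ≥0 → Kernel (GaugeConfig 3 L (Matrix.specialUnitaryGroup (Fin 2) ℂ)) (GaugeConfig 3 L (Matrix.specialUnitaryGroup (Fin 2) ℂ))) [∀ t, IsMarkovKernel (κ t)]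
      (β : ℝ) (hreal : ∀ (t : ℝ≥0) (x : GaugeConfig 3 L (Matrix.specialUnitaryGroup (Fin 2) ℂ))
        (Ω : Type) [MeasurableSpace Ω] (P : Measure Ω) [IsProbabilityMeasure P]
        (W : ℝ≥0 → Ω → (Edge 3 L × NoiseIdx 2 → ℝ)) (hW : IsFlatBrownian W P)
        (U : ℝ≥0 → Ω → GaugeConfig 3 L (Matrix.specialUnitaryGroup (Fin 2) ℂ)),
        (∀ ω, U 0 ω = x) →
        (latticeLangevinDynamics (fundamentalLatticeRep 2) β).IsSolution (fundamentalRep (Fin 2))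
          hW.natFiltration P W U →
        κ t x = P.map (U t)) {Φ : (GaugeConfig 3 L (Matrix.specialUnitaryGroup (Fin 2) ℂ)) → ℝ}, Continuous Φ → ∀ x : (GaugeConfig 3 L (Matrix.specialUnitaryGroup (Fin 2) ℂ)), Continuous fun τ : ℝ => ∫ y, Φ y ∂(κ τ.toNNReal x) :=
    fun κ _ β hreal Φ hΦ x => (continuous_transitionKernel_action (L := L) β κ hreal hΦ).comp (continuous_real_toNNReal.prodMk continuous_const)
  have h01 : ∀ {Φ : (GaugeConfig 3 L (Matrix.specialUnitaryGroup (Fin 2) ℂ)) → ℝ}, Continuous Φ → ∀ x : (GaugeConfig 3 L (Matrix.specialUnitaryGroup (Fin 2) ℂ)), ∫ y, Φ y ∂(κ₁ (0 : ℝ).toNNReal x) = Φ x := by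
    intro Φ hΦ x
    rw [Real.toNNReal_zero, hκ10, Kernel.id_apply, integral_dirac' _ _ hΦ.measurable.stronglyMeasurable]
  have h02 : ∀ {Φ : (GaugeConfig 3 L (Matrix.specialUnitaryGroup (Fin 2) ℂ)) → ℝ}, Continuous Φ → ∀ x : (GaugeConfig 3 L (Matrix.specialUnitaryGroup (Fin 2) ℂ)), ∫ y, Φ y ∂(κ₂ (0 : ℝ).toNNReal x) = Φ x := by
    intro Φ hΦ x
    rw [Real.toNNReal_zero, hκ20, Kernel.id_apply, integral_dirac' _ _ hΦ.measurable.stronglyMeasurable]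
  obtain ⟨MFb, hMFb⟩ := hbd κ₂ cF; obtain ⟨MAF, hMAF⟩ := hbd κ₂ cAf
  obtain ⟨MH, hMH⟩ := hbd κ₁ cH; obtain ⟨MB, hMB⟩ := hbd κ₁ cBh
  have bF : ∀ τ x, |PF τ x| ≤ MFb := fun τ x => by rw [hPF]; exact hMFb τ x
  have bAF : ∀ τ x, |PAF τ x| ≤ MAF := fun τ x => by rw [hPAF]; exact hMAF τ x
  have bH : ∀ τ x, |PH τ x| ≤ MH := fun τ x => by rw [hPH]; exact hMH τ x
  have bB : ∀ τ x, |PB τ x| ≤ MB := fun τ x => by rw [hPB]; exact hMB τ x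
  have cxF : ∀ τ, Continuous fun x => PF τ x := fun τ => by rw [hPF]; exact hcx κ₂ β₂ hreal₂ cF τ
  have cxAF : ∀ τ, Continuous fun x => PAF τ x := fun τ => by rw [hPAF]; exact hcx κ₂ β₂ hreal₂ cAf τ
  have cxH : ∀ τ, Continuous fun x => PH τ x := fun τ => by rw [hPH]; exact hcx κ₁ β₁ hreal₁ cH τ
  have cxB : ∀ τ, Continuous fun x => PB τ x := fun τ => by rw [hPB]; exact hcx κ₁ β₁ hreal₁ cBh τ
  have ctF : ∀ x, Continuous fun τ => PF τ x := fun x => by rw [hPF]; exact hct κ₂ β₂ hreal₂ cF x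
  have ctH : ∀ x, Continuous fun τ => PH τ x := fun x => by rw [hPH]; exact hct κ₁ β₁ hreal₁ cH x
  have dF : ∀ x {τ : ℝ}, 0 < τ → HasDerivAt (fun τ => PF τ x) (PAF τ x) τ := fun x τ hτ => by
    rw [hPF, hPAF]; exact hDer2 hf hfc x hτ
  have dH : ∀ x {τ : ℝ}, 0 < τ → HasDerivAt (fun τ => PH τ x) (PB τ x) τ := fun x τ hτ => by
    rw [hPH, hPB]; exact hDer1 hh hhc x hτ
  -- §3 `Ψ(s) = ∫ κ¹_sH·κ²_(T−s)F dμ₁`, its derivative `Λ`, and the bound `Mb`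
  set T : ℝ := (t : ℝ) with hT
  have hT0 : 0 ≤ T := t.coe_nonneg; have hTt : T.toNNReal = t := by rw [hT, Real.toNNReal_coe]
  obtain ⟨Ψ, hΨ⟩ : ∃ Ψ : ℝ → ℝ, Ψ = fun σ => ∫ x, PH σ x * PF (T - σ) x ∂μ := ⟨_, rfl⟩
  obtain ⟨Λ, hΛ⟩ : ∃ Λ : ℝ → ℝ, Λ = fun σ => ∫ x, (PB σ x * PF (T - σ) x - PH σ x * PAF (T - σ) x) ∂μ := ⟨_, rfl⟩
  set Mb : ℝ := 13824 * Real.pi * |β₁ - β₂| * Real.exp (lam * T) * SF * IH with hMb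
  have hΨc : Continuous Ψ := by
    rw [hΨ]
    refine continuous_of_dominated (bound := fun _ => MH * MFb) (fun σ => ?_) (fun σ => ?_)
      (integrable_const _) (ae_of_all _ fun x => ?_)
    · exact ((cxH σ).mul (cxF _)).aestronglyMeasurable
    · exact ae_of_all _ fun x => by
        rw [Real.norm_eq_abs, abs_mul]; exact mul_le_mul (bH σ x) (bF (T - σ) x) (abs_nonneg _) ((abs_nonneg _).trans (bH σ x))
    · have cs : Continuous fun σ : ℝ => T - σ := continuous_const.sub continuous_id
      exact (ctH x).mul ((ctF x).comp cs)
  have hΨder : ∀ σ ∈ Ioo 0 T, HasDerivAt Ψ (Λ σ) σ := by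
    intro σ ⟨hσ0, hσT⟩
    rw [hΨ, hΛ]
    have hs : Ioo (σ / 2) ((σ + T) / 2) ∈ 𝓝 σ := Ioo_mem_nhds (by linarith) (by linarith)
    refine (hasDerivAt_integral_of_dominated_loc_of_deriv_le (μ := μ) (x₀ := σ)
      (F := fun σ x => PH σ x * PF (T - σ) x)
      (F' := fun σ x => PB σ x * PF (T - σ) x - PH σ x * PAF (T - σ) x)
      (bound := fun _ => MB * MFb + MH * MAF) hs ?_ ?_ ?_ ?_ (integrable_const _) ?_).2
    · exact Filter.Eventually.of_forall fun σ' => ((cxH σ').mul (cxF _)).aestronglyMeasurable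
    · exact hInt ((cxH σ).mul (cxF _))
    · exact (((cxB σ).mul (cxF _)).sub ((cxH σ).mul (cxAF _))).aestronglyMeasurable
    · refine ae_of_all _ fun x σ' _ => ?_
      rw [Real.norm_eq_abs]
      refine (abs_sub _ _).trans (add_le_add ?_ ?_)
      · rw [abs_mul]; exact mul_le_mul (bB σ' x) (bF (T - σ') x) (abs_nonneg _) ((abs_nonneg _).trans (bB σ' x))
      · rw [abs_mul]; exact mul_le_mul (bH σ' x) (bAF (T - σ') x) (abs_nonneg _) ((abs_nonneg _).trans (bH σ' x))
    · refine ae_of_all _ fun x σ' ⟨hσ'1, hσ'2⟩ => ?_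
      have hσ'0 : 0 < σ' := by linarith
      have hTσ' : 0 < T - σ' := by linarith
      have eH := dH x hσ'0
      have eF : HasDerivAt (fun σ => PF (T - σ) x) (-(PAF (T - σ') x)) σ' := by
        have hc := HasDerivAt.comp σ' (dF x hTσ') ((hasDerivAt_id σ').const_sub T)
        exact hc.congr_deriv (by ring)
      have hall := eH.mul eF
      show HasDerivAt (fun σ => PH σ x * PF (T - σ) x) (PB σ' x * PF (T - σ') x - PH σ' x * PAF (T - σ') x) σ'
      refine hall.congr_deriv ?_
      ring
  -- §4 the key bound `|Λ(s)| ≤ Mb` on `(0, T)`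
  have hkey : ∀ σ ∈ Ioo 0 T, |Λ σ| ≤ Mb := by
    intro σ hσ
    obtain ⟨hσ0, hσT⟩ := hσ
    set s₁ : ℝ≥0 := σ.toNNReal with hs₁
    set s₂ : ℝ≥0 := (T - σ).toNNReal with hs₂
    have hs₂R : ((s₂ : ℝ≥0) : ℝ) = T - σ := by rw [hs₂, Real.coe_toNNReal _ (by linarith)]
    have eH : ∀ x, PH σ x = gH s₁ (coords x) := fun x => by rw [hPH]; exact hgHrep' s₁ x
    have eB : ∀ x, PB σ x = gen₁ (gH s₁) x := fun x => by rw [hPB, hgHcomm' s₁ x]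
    have eF : ∀ x, PF (T - σ) x = gF s₂ (coords x) := fun x => by rw [hPF]; exact hgFrep' s₂ x
    have eAF : ∀ x, PAF (T - σ) x = gen₂ (gF s₂) x := fun x => by rw [hPAF, hgFcomm' s₂ x]
    have hG0 : ∀ x, 0 ≤ gH s₁ (coords x) := fun x => by
      rw [← hgHrep' s₁ x]
      exact integral_nonneg fun y => hh0 y
    have cG1 : Continuous fun x : (GaugeConfig 3 L (Matrix.specialUnitaryGroup (Fin 2) ℂ)) => gH s₁ (coords x) := (hgH s₁).continuous.comp hco
    have cu : Continuous fun x : (GaugeConfig 3 L (Matrix.specialUnitaryGroup (Fin 2) ℂ)) => gF s₂ (coords x) := (hgF s₂).continuous.comp hco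
    have cg1u : Continuous (gen₁ (gF s₂)) := continuous_generator (L := L) β₁ ((hgF s₂).of_le (by norm_num))
    have cg2u : Continuous (gen₂ (gF s₂)) := continuous_generator (L := L) β₂ ((hgF s₂).of_le (by norm_num))
    have cg1H : Continuous (gen₁ (gH s₁)) := continuous_generator (L := L) β₁ ((hgH s₁).of_le (by norm_num))
    -- symmetry of `𝓛_(β₁)` under `μ_(β₁)`
    have hsymm : ∫ x, (gF s₂ (coords x)) * gen₁ (gH s₁) x ∂μ = ∫ x, gH s₁ (coords x) * gen₁ (gF s₂) x ∂μ :=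
      integral_mul_generator_symm L β₁ (hgH s₁) (hgHc s₁) (hgF s₂) (hgFc s₂)
    have hΛσ : Λ σ = ∫ x, gH s₁ (coords x) * (gen₁ (gF s₂) x - gen₂ (gF s₂) x) ∂μ := by
      rw [hΛ]
      have i1 : Integrable (fun x => (gF s₂ (coords x)) * gen₁ (gH s₁) x) μ := hInt (cu.mul cg1H)
      have i2 : Integrable (fun x => gH s₁ (coords x) * gen₂ (gF s₂) x) μ := hInt (cG1.mul cg2u)
      have i3 : Integrable (fun x => gH s₁ (coords x) * gen₁ (gF s₂) x) μ := hInt (cG1.mul cg1u)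
      calc (fun σ => ∫ x, (PB σ x * PF (T - σ) x - PH σ x * PAF (T - σ) x) ∂μ) σ
          = ∫ x, ((gF s₂ (coords x)) * gen₁ (gH s₁) x - gH s₁ (coords x) * gen₂ (gF s₂) x) ∂μ :=
            integral_congr_ae (ae_of_all _ fun x => by simp only [eB x, eH x, eF x, eAF x]; ring)
        _ = ∫ x, (gF s₂ (coords x)) * gen₁ (gH s₁) x ∂μ - ∫ x, gH s₁ (coords x) * gen₂ (gF s₂) x ∂μ := integral_sub i1 i2
        _ = ∫ x, gH s₁ (coords x) * gen₁ (gF s₂) x ∂μ - ∫ x, gH s₁ (coords x) * gen₂ (gF s₂) x ∂μ := by rw [hsymm]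
        _ = ∫ x, gH s₁ (coords x) * (gen₁ (gF s₂) x - gen₂ (gF s₂) x) ∂μ := by
            rw [← integral_sub i3 i2]; exact integral_congr_ae (ae_of_all _ fun x => by ring)
    -- Lieb–Robinson profile of `gF s₂` (coupling `β₂`) and the locality of `𝓛_(β₁) − 𝓛_(β₂)`
    set MF : Edge 3 L → ℝ := fun e => ∑ e' : Edge 3 L, ℓF e' * ((108 : ℝ)⁻¹) ^ (Finset.univ.sup fun i : Fin 3 => ((e'.1 i - e.1 i).valMinAbs).natAbs) with hMF
    have hMF0 : ∀ e, 0 ≤ MF e := fun e => Finset.sum_nonneg fun e' _ => mul_nonneg (hℓF e') (by positivity)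
    have hLF : ∀ (e : Edge 3 L) (y y' : (GaugeConfig 3 L (Matrix.specialUnitaryGroup (Fin 2) ℂ))), (∀ f', f' ≠ e → y f' = y' f') →
        |gF s₂ (coords y) - gF s₂ (coords y')| ≤ (Real.exp (lam * (s₂ : ℝ)) * MF e) * frobNorm ((y e : Matrix (Fin 2) (Fin 2) ℂ) - (y' e : Matrix (Fin 2) (Fin 2) ℂ)) := by
      intro e y y' hyy'
      rw [← hgFrep' s₂ y, ← hgFrep' s₂ y']
      have h1 := transitionKernel_linkLipschitz_profile L β₂ κ₂ hreal₂ cF hℓF hLf s₂ e y y' hyy'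
      rw [hMF]; exact h1
    have hmF0 : ∀ e, 0 ≤ Real.exp (lam * (s₂ : ℝ)) * MF e := fun e => mul_nonneg (Real.exp_nonneg _) (hMF0 e)
    have hgen : ∀ x : (GaugeConfig 3 L (Matrix.specialUnitaryGroup (Fin 2) ℂ)), |gen₁ (gF s₂) x - gen₂ (gF s₂) x| ≤ 2304 * Real.pi * |β₁ - β₂| * ∑ e : Edge 3 L, Real.exp (lam * (s₂ : ℝ)) * MF e :=
      fun x => abs_generator_sub_generator_le L β₁ β₂ ((hgF s₂).of_le (by norm_num)) hmF0 x hLF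
    -- the volume-free sum `Σ_e MF_e ≤ 6 Σℓ^F`
    have hsumMF : ∑ e : Edge 3 L, MF e ≤ 6 * SF := by
      rw [hMF, Finset.sum_comm, hSF, Finset.mul_sum]
      refine Finset.sum_le_sum fun e' _ => ?_
      rw [← Finset.mul_sum, mul_comm (6 : ℝ)]
      refine mul_le_mul_of_nonneg_left ?_ (hℓF e')
      calc ∑ e : Edge 3 L, ((108 : ℝ)⁻¹) ^ (Finset.univ.sup fun i : Fin 3 => ((e'.1 i - e.1 i).valMinAbs).natAbs)
          ≤ ∑ e : Edge 3 L, ((54 : ℝ)⁻¹) ^ (Finset.univ.sup fun i : Fin 3 => ((e.1 i - e'.1 i).valMinAbs).natAbs) :=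
            Finset.sum_le_sum fun e _ => by
              rw [torusDist_comm e.1 e'.1]
              exact pow_le_pow_left₀ (by norm_num) (by norm_num) _
        _ ≤ 6 := sum_edge_pow_torusDist_le (L := L) e'.1
    have hexp : Real.exp (lam * (s₂ : ℝ)) ≤ Real.exp (lam * T) := by
      rw [Real.exp_le_exp, hs₂R]; nlinarith [mul_nonneg hlam0 hσ0.le]
    have hgen' : ∀ x : (GaugeConfig 3 L (Matrix.specialUnitaryGroup (Fin 2) ℂ)), |gen₁ (gF s₂) x - gen₂ (gF s₂) x| ≤ 13824 * Real.pi * |β₁ - β₂| * Real.exp (lam * T) * SF := by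
      intro x
      refine (hgen x).trans ?_
      rw [← Finset.mul_sum]
      have h6 : Real.exp (lam * (s₂ : ℝ)) * ∑ e : Edge 3 L, MF e ≤ Real.exp (lam * T) * (6 * SF) :=
        mul_le_mul hexp hsumMF (Finset.sum_nonneg fun e _ => hMF0 e) (Real.exp_nonneg _)
      have hpre : 0 ≤ 2304 * Real.pi * |β₁ - β₂| := by positivity
      calc 2304 * Real.pi * |β₁ - β₂| * (Real.exp (lam * (s₂ : ℝ)) * ∑ e : Edge 3 L, MF e)
          ≤ 2304 * Real.pi * |β₁ - β₂| * (Real.exp (lam * T) * (6 * SF)) := mul_le_mul_of_nonneg_left h6 hpre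
        _ = _ := by ring
    have hptx : ∀ x : (GaugeConfig 3 L (Matrix.specialUnitaryGroup (Fin 2) ℂ)), |gH s₁ (coords x) * (gen₁ (gF s₂) x - gen₂ (gF s₂) x)| ≤
        (13824 * Real.pi * |β₁ - β₂| * Real.exp (lam * T) * SF) * gH s₁ (coords x) := by
      intro x
      rw [abs_mul, abs_of_nonneg (hG0 x), mul_comm]
      exact mul_le_mul_of_nonneg_right (hgen' x) (hG0 x)
    have hinv : ∫ x, gH s₁ (coords x) ∂μ = IH := by
      rw [hIH]
      have h1 : ∫ x, gH s₁ (coords x) ∂μ = ∫ x, (∫ y, h (coords y) ∂(κ₁ s₁ x)) ∂μ := integral_congr_ae (ae_of_all _ fun x => (hgHrep' s₁ x).symm)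
      rw [h1]
      exact integral_transitionKernel_integral_eq_wilson (L := L) β₁ κ₁ hreal₁ s₁ cH.measurable ⟨MH, fun x => by
        have := hMH 0 x; rw [h01 cH x] at this; exact this⟩
    rw [hΛσ]
    calc |∫ x, gH s₁ (coords x) * (gen₁ (gF s₂) x - gen₂ (gF s₂) x) ∂μ|
        ≤ ∫ x, |gH s₁ (coords x) * (gen₁ (gF s₂) x - gen₂ (gF s₂) x)| ∂μ := MeasureTheory.abs_integral_le_integral_abs
      _ ≤ ∫ x, (13824 * Real.pi * |β₁ - β₂| * Real.exp (lam * T) * SF) * gH s₁ (coords x) ∂μ :=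
          integral_mono_of_nonneg (ae_of_all _ fun x => abs_nonneg _) ((hInt cG1).const_mul _) (ae_of_all _ fun x => hptx x)
      _ = Mb := by rw [MeasureTheory.integral_const_mul, hinv, hMb]
  -- §5 monotonicity
  have hup : AntitoneOn (fun σ => Ψ σ - Mb * σ) (Icc 0 T) := by
    have hΘc : ContinuousOn (fun σ => Ψ σ - Mb * σ) (Icc 0 T) := (hΨc.sub (continuous_const.mul continuous_id)).continuousOn
    have hΘd : ∀ σ ∈ Ioo 0 T, HasDerivAt (fun σ => Ψ σ - Mb * σ) (Λ σ - Mb * 1) σ := fun σ hσ =>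
      (hΨder σ hσ).sub ((hasDerivAt_id' σ).const_mul Mb)
    refine antitoneOn_of_deriv_nonpos (convex_Icc 0 T) hΘc (fun σ hσ => ?_) (fun σ hσ => ?_)
    · rw [interior_Icc] at hσ
      exact (hΘd σ hσ).differentiableAt.differentiableWithinAt
    · rw [interior_Icc] at hσ
      rw [(hΘd σ hσ).deriv]
      have h := (abs_le.1 (hkey σ hσ)).2
      linarith
  have hdown : MonotoneOn (fun σ => Ψ σ + Mb * σ) (Icc 0 T) := by
    have hΘc : ContinuousOn (fun σ => Ψ σ + Mb * σ) (Icc 0 T) := (hΨc.add (continuous_const.mul continuous_id)).continuousOn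
    have hΘd : ∀ σ ∈ Ioo 0 T, HasDerivAt (fun σ => Ψ σ + Mb * σ) (Λ σ + Mb * 1) σ := fun σ hσ =>
      (hΨder σ hσ).add ((hasDerivAt_id' σ).const_mul Mb)
    refine monotoneOn_of_deriv_nonneg (convex_Icc 0 T) hΘc (fun σ hσ => ?_) (fun σ hσ => ?_)
    · rw [interior_Icc] at hσ
      exact (hΘd σ hσ).differentiableAt.differentiableWithinAt
    · rw [interior_Icc] at hσ
      rw [(hΘd σ hσ).deriv]
      have h := (abs_le.1 (hkey σ hσ)).1
      linarith
  have hΘup := hup (left_mem_Icc.2 hT0) (right_mem_Icc.2 hT0) hT0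
  have hΘdown := hdown (left_mem_Icc.2 hT0) (right_mem_Icc.2 hT0) hT0
  simp only [mul_zero, sub_zero, add_zero] at hΘup hΘdown
  -- §6 endpoints
  have hΨT : Ψ T = ∫ x, h (coords x) * (∫ y, f (coords y) ∂(κ₁ t x)) ∂μ := by
    have eF : ∀ x, PF (T - T) x = f (coords x) := fun x => by rw [hPF, sub_self]; exact h02 cF x
    have eH : ∀ x, PH T x = ∫ y, h (coords y) ∂(κ₁ t x) := fun x => by rw [hPH]; show ∫ y, h (coords y) ∂(κ₁ T.toNNReal x) = _; rw [hTt]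
    rw [hΨ]
    calc (fun σ => ∫ x, PH σ x * PF (T - σ) x ∂μ) T = ∫ x, (∫ y, h (coords y) ∂(κ₁ t x)) * f (coords x) ∂μ :=
          integral_congr_ae (ae_of_all _ fun x => by simp only [eF x, eH x])
      _ = ∫ x, f (coords x) * (∫ y, h (coords y) ∂(κ₁ t x)) ∂μ := integral_congr_ae (ae_of_all _ fun x => mul_comm _ _)
      _ = ∫ x, h (coords x) * (∫ y, f (coords y) ∂(κ₁ t x)) ∂μ := (integral_mul_transition_symm_su2 L β₁ κ₁ hreal₁ t cH cF).symm
  have hΨ0 : Ψ 0 = ∫ x, h (coords x) * (∫ y, f (coords y) ∂(κ₂ t x)) ∂μ := by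
    have eF : ∀ x, PF T x = ∫ y, f (coords y) ∂(κ₂ t x) := fun x => by rw [hPF]; show ∫ y, f (coords y) ∂(κ₂ T.toNNReal x) = _; rw [hTt]
    have eH : ∀ x, PH 0 x = h (coords x) := fun x => by rw [hPH]; exact h01 cH x
    rw [hΨ]
    exact integral_congr_ae (ae_of_all _ fun x => by simp only [sub_zero, eF x, eH x])
  rw [← hΨT, ← hΨ0]
  have hMbT : Mb * T = 13824 * Real.pi * |β₁ - β₂| * (t : ℝ) * Real.exp (lam * T) * SF * IH := by rw [hMb, hT]; ring
  rw [abs_le]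
  constructor <;> linarith [hΘup, hΘdown, hMbT]

end Summit.QuantumFields.YangMills.Theorems.ColdStartUniversality.LiebRobinson

end
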